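import Mathlib.Analysis.SpecialFunctions.ExpDeriv
import Mathlib.Analysis.Calculus.Deriv.MeanValue
import Mathlib.Analysis.Calculus.Deriv.Mul
import Mathlib.Analysis.Normed.Operator.Bilinear
import HarnessLib

/-!
# Quadratic Lyapunov / cone certificates for linear systems `d' = A(t) d`: no fast-decaying solutions
# under a lower growth certificate, and no bounded solutions in a strictly expanding cone

Topic `Literature/Analysis/ODE` (namespace `Literature.Analysis.ODE`). Everything here is PROVED (no named
fact, no definition, no `sorry`). Two folklore lemmas of Lyapunov's direct method for a (possibly
non-autonomous) LINEAR equation `d'(t) = A(t) d(t)` on a real normed space, `t ≥ t₀`, phrased with a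
continuous bilinear form as the certificate (Hartman, *Ordinary Differential Equations*, Ch. IV §§1–2
(Grönwall-type one-sided estimates through `d/dt B(d,d)`), Ch. IX (cones / dichotomies near a saddle);
Katok–Hasselblatt §6.2 "cone criterion"):

* `eq_zero_of_norm_le_exp_of_lower_certificate` — **LOWER GROWTH CERTIFICATE KILLS FAST DECAY.** If a
  coercive form `B` (`c‖v‖² ≤ B(v,v)`) satisfies `B(A(t)v, v) + B(v, A(t)v) ≥ 2μ B(v,v)` for `t ≥ t₀`,
  then `t ↦ e^{−2μt} B(d(t), d(t))` is non-decreasing along every solution; so a solution with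
  `‖d(t)‖ ≤ C e^{−λt}`, `λ + μ > 0`, vanishes at `t₀` (hence identically, by uniqueness — not needed here).
* `eq_zero_of_bounded_of_cone_certificate` — **STRICT CONE CERTIFICATE KILLS BOUNDED SOLUTIONS.** If a
  form `Q` (any signature) satisfies the S-procedure inequality
  `Q(A(t)v, v) + Q(v, A(t)v) ≥ η‖v‖² + 2θ Q(v,v)` (`η > 0`, `θ ≥ 0`) for `t ≥ 0`, then along a solution
  with `Q(d(0), d(0)) ≥ 0` the quantity `q = Q(d,d)` stays `≥ 0` and increases at rate `≥ η‖d‖²`, so a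
  solution bounded on `[0, ∞)` must have `d(0) = 0`; contrapositive packaging
  `cone_certificate_neg_of_bounded`: bounded and `d(0) ≠ 0` ⇒ `Q(d(0), d(0)) < 0`.

These are the two halves of the "kill / thin" node dichotomy used for stationary self-similar Euler
profiles in `Literature/Analysis/FluidPDE/SelfSimilarEuler*` (vorticity transported along backward
self-similar trajectories; points whose backward orbit stays near a stagnation point): the first with
`A(t) → −DV(z)` and the decay rate `1 + γ` of the self-similar Cauchy formula, the second with the
difference of two trajectories near a stagnation point admitting an expanding cone.

## References

* P. Hartman, *Ordinary Differential Equations*, SIAM Classics 38 (2002), Ch. IV Lemma 4.1–4.2, Ch. IX.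
  [Hartman2002]
* A. Katok, B. Hasselblatt, *Introduction to the Modern Theory of Dynamical Systems*, CUP 1995, §6.2
  (invariant cones). [KatokHasselblatt1995]
-/

noncomputable section

open Set Filter Topology

namespace Literature.Analysis.ODE

variable {E : Type*} [NormedAddCommGroup E] [NormedSpace ℝ E]

/-! ### The derivative of a quadratic form along a solution -/

/-- Chain rule: along `d' = A(t) d`, the quadratic quantity `Q(d,d)` has derivative
`Q(A d, d) + Q(d, A d)`. [folklore] -/
private theorem hasDerivAt_bilin_self (Q : E →L[ℝ] E →L[ℝ] ℝ) {d : ℝ → E} {d' : E} {t : ℝ}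
    (hd : HasDerivAt d d' t) :
    HasDerivAt (fun s => Q (d s) (d s)) (Q d' (d t) + Q (d t) d') t := by
  have h1 : HasDerivAt (fun s => Q (d s)) (Q d') t := Q.hasFDerivAt.comp_hasDerivAt t hd
  exact h1.clm_apply hd

/-- `|Q(v,v)| ≤ ‖Q‖ ‖v‖²` for a continuous bilinear form. [folklore] -/
private theorem bilin_self_le_opNorm_mul (Q : E →L[ℝ] E →L[ℝ] ℝ) (v : E) : Q v v ≤ ‖Q‖ * ‖v‖ ^ 2 := by
  calc Q v v ≤ ‖Q v v‖ := Real.le_norm_self _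
    _ ≤ ‖Q‖ * ‖v‖ * ‖v‖ := Q.le_opNorm₂ v v
    _ = ‖Q‖ * ‖v‖ ^ 2 := by ring

/-- The weighted quantity `e^{a t} Q(d,d)` along `d' = A(t) d` has derivative
`e^{a t}(a Q(d,d) + Q(A d, d) + Q(d, A d))`. [folklore] -/
private theorem hasDerivAt_exp_mul_bilin_self (Q : E →L[ℝ] E →L[ℝ] ℝ) {A : ℝ → E →L[ℝ] E} {d : ℝ → E}
    {t : ℝ} (hd : HasDerivAt d (A t (d t)) t) (a : ℝ) :
    HasDerivAt (fun s => Real.exp (a * s) * Q (d s) (d s))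
      (Real.exp (a * t) * (a * Q (d t) (d t) + (Q (A t (d t)) (d t) + Q (d t) (A t (d t))))) t := by
  have h1 : HasDerivAt (fun s : ℝ => Real.exp (a * s)) (Real.exp (a * t) * (a * 1)) t :=
    ((hasDerivAt_id t).const_mul a).exp
  have h2 := hasDerivAt_bilin_self Q hd
  refine (h1.mul h2).congr_deriv ?_
  ring

/-! ### A lower growth certificate kills fast-decaying solutions -/

/-- **Monotonicity under a lower growth certificate.** If `B(A(t)v,v) + B(v,A(t)v) ≥ 2μ B(v,v)` for all
`t ∈ [t₀, ∞)` and all `v`, then `t ↦ e^{−2μ t} B(d(t), d(t))` is non-decreasing on `[t₀, ∞)` along every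
solution of `d' = A(t) d`. [cite: Hartman2002, Ch. IV Lemma 4.1 (one-sided Grönwall via d/dt of a quadratic form)] -/
theorem monotoneOn_exp_mul_bilin_self (B : E →L[ℝ] E →L[ℝ] ℝ) {A : ℝ → E →L[ℝ] E} {d : ℝ → E}
    {t₀ μ : ℝ} (hd : ∀ t, t₀ ≤ t → HasDerivAt d (A t (d t)) t)
    (hA : ∀ t, t₀ ≤ t → ∀ v, 2 * μ * B v v ≤ B (A t v) v + B v (A t v)) :
    MonotoneOn (fun s => Real.exp (-(2 * μ) * s) * B (d s) (d s)) (Ici t₀) := by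
  have hderiv : ∀ t ∈ Ici t₀, HasDerivAt (fun s => Real.exp (-(2 * μ) * s) * B (d s) (d s))
      (Real.exp (-(2 * μ) * t) * (-(2 * μ) * B (d t) (d t) +
        (B (A t (d t)) (d t) + B (d t) (A t (d t))))) t :=
    fun t ht => hasDerivAt_exp_mul_bilin_self B (hd t ht) _
  refine monotoneOn_of_hasDerivWithinAt_nonneg (convex_Ici t₀)
    (fun t ht => (hderiv t ht).continuousAt.continuousWithinAt)
    (fun t ht => ((hderiv t (interior_subset ht)).hasDerivWithinAt)) ?_
  intro t ht
  have ht' : t₀ ≤ t := le_of_lt (by simpa using ht)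
  have h := hA t ht' (d t)
  exact mul_nonneg (Real.exp_pos _).le (by linarith)

/-- **A lower growth certificate kills fast decay.** Let `B` be a coercive continuous bilinear form
(`c‖v‖² ≤ B(v,v)`, `c > 0`) with `B(A(t)v,v) + B(v,A(t)v) ≥ 2μ B(v,v)` for `t ≥ t₀`, and let `d` solve
`d' = A(t) d` on `[t₀, ∞)` with `‖d(t)‖ ≤ C e^{−λ t}` there.  If `λ + μ > 0` (the solution decays faster
than the certificate allows), then `d(t₀) = 0`.  Proof: `e^{−2μt}B(d,d)` is non-decreasing and bounded by
`‖B‖C² e^{−2(λ+μ)t} → 0`. [cite: Hartman2002, Ch. IV Lemma 4.1–4.2] -/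
theorem eq_zero_of_norm_le_exp_of_lower_certificate (B : E →L[ℝ] E →L[ℝ] ℝ) {c : ℝ} (hc : 0 < c)
    (hB : ∀ v, c * ‖v‖ ^ 2 ≤ B v v) {A : ℝ → E →L[ℝ] E} {d : ℝ → E} {t₀ μ : ℝ}
    (hd : ∀ t, t₀ ≤ t → HasDerivAt d (A t (d t)) t)
    (hA : ∀ t, t₀ ≤ t → ∀ v, 2 * μ * B v v ≤ B (A t v) v + B v (A t v))
    {C lam : ℝ} (hdecay : ∀ t, t₀ ≤ t → ‖d t‖ ≤ C * Real.exp (-lam * t)) (hgap : 0 < lam + μ) :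
    d t₀ = 0 := by
  have hmono := monotoneOn_exp_mul_bilin_self B hd hA
  set φ : ℝ → ℝ := fun s => Real.exp (-(2 * μ) * s) * B (d s) (d s) with hφ
  -- upper bound `φ t ≤ ‖B‖ C² e^{-2(λ+μ) t}` for `t ≥ t₀`
  have hC : 0 ≤ C := by
    have h := hdecay t₀ le_rfl
    have hpos : 0 < Real.exp (-lam * t₀) := Real.exp_pos _
    nlinarith [norm_nonneg (d t₀)]
  have hbound : ∀ t, t₀ ≤ t → φ t ≤ ‖B‖ * C ^ 2 * Real.exp (-(2 * (lam + μ)) * t) := by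
    intro t ht
    have h1 : B (d t) (d t) ≤ ‖B‖ * ‖d t‖ ^ 2 := bilin_self_le_opNorm_mul B (d t)
    have h2 : ‖d t‖ ^ 2 ≤ (C * Real.exp (-lam * t)) ^ 2 :=
      pow_le_pow_left₀ (norm_nonneg _) (hdecay t ht) 2
    have h3 : B (d t) (d t) ≤ ‖B‖ * (C * Real.exp (-lam * t)) ^ 2 :=
      h1.trans (mul_le_mul_of_nonneg_left h2 (norm_nonneg B))
    have hexp : Real.exp (-(2 * μ) * t) * (‖B‖ * (C * Real.exp (-lam * t)) ^ 2)
        = ‖B‖ * C ^ 2 * Real.exp (-(2 * (lam + μ)) * t) := by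
      have : (Real.exp (-lam * t)) ^ 2 = Real.exp (2 * (-lam * t)) := by
        rw [← Real.exp_nat_mul]; norm_num
      rw [mul_pow, this, show ‖B‖ * (C ^ 2 * Real.exp (2 * (-lam * t))) =
        (‖B‖ * C ^ 2) * Real.exp (2 * (-lam * t)) by ring, ← mul_assoc,
        mul_comm (Real.exp _) (‖B‖ * C ^ 2), mul_assoc, ← Real.exp_add]
      congr 2; ring
    calc φ t = Real.exp (-(2 * μ) * t) * B (d t) (d t) := rfl
      _ ≤ Real.exp (-(2 * μ) * t) * (‖B‖ * (C * Real.exp (-lam * t)) ^ 2) :=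
          mul_le_mul_of_nonneg_left h3 (Real.exp_pos _).le
      _ = ‖B‖ * C ^ 2 * Real.exp (-(2 * (lam + μ)) * t) := hexp
  -- the bound tends to `0`, and `φ t₀ ≤ φ t` for all `t ≥ t₀`; hence `φ t₀ ≤ 0`
  have hlim : Tendsto (fun t => ‖B‖ * C ^ 2 * Real.exp (-(2 * (lam + μ)) * t)) atTop (𝓝 0) := by
    have h : Tendsto (fun t => Real.exp (-(2 * (lam + μ)) * t)) atTop (𝓝 0) := by
      have := Real.tendsto_exp_neg_atTop_nhds_zero.comp
        (tendsto_id.const_mul_atTop (show (0 : ℝ) < 2 * (lam + μ) by linarith))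
      refine this.congr fun t => ?_
      simp only [Function.comp, id]; congr 1; ring
    simpa using h.const_mul (‖B‖ * C ^ 2)
  have hφt₀ : φ t₀ ≤ 0 := by
    refine ge_of_tendsto hlim ?_
    filter_upwards [eventually_ge_atTop t₀] with t ht
    exact (hmono (self_mem_Ici) (mem_Ici.2 ht) ht).trans (hbound t ht)
  -- coercivity
  have hBd : B (d t₀) (d t₀) ≤ 0 := by
    have hpos : 0 < Real.exp (-(2 * μ) * t₀) := Real.exp_pos _
    have : Real.exp (-(2 * μ) * t₀) * B (d t₀) (d t₀) ≤ 0 := hφt₀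
    by_contra hneg
    push Not at hneg
    have := mul_pos hpos hneg
    linarith
  have hsq : ‖d t₀‖ ^ 2 ≤ 0 := by
    have := hB (d t₀)
    nlinarith
  have : ‖d t₀‖ = 0 := by nlinarith [norm_nonneg (d t₀)]
  exact norm_eq_zero.1 this

/-! ### A strict cone certificate kills bounded solutions -/

/-- **A strict cone certificate kills bounded solutions.** Let `Q` be a continuous bilinear form and
`η > 0`, `θ ≥ 0` with the S-procedure inequality `Q(A(t)v,v) + Q(v,A(t)v) ≥ η‖v‖² + 2θ Q(v,v)` for all
`t ≥ 0` and all `v`.  If `d` solves `d' = A(t) d` on `[0, ∞)`, is bounded there, and starts in the closed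
cone `Q(d(0), d(0)) ≥ 0`, then `d(0) = 0`.  Proof: `e^{−2θt}Q(d,d)` is non-decreasing, so `Q(d,d) ≥ 0`
throughout; then `(Q(d,d))' ≥ η‖d‖² ≥ η Q(d,d)/(‖Q‖+1)`, so once `Q(d,d) > 0` it grows at least linearly,
contradicting boundedness; and `Q(d,d) ≡ 0` forces `η‖d‖² ≤ 0`.
[cite: KatokHasselblatt1995, §6.2 (cone criterion)] [cite: Hartman2002, Ch. IX] -/
theorem eq_zero_of_bounded_of_cone_certificate (Q : E →L[ℝ] E →L[ℝ] ℝ) {η θ : ℝ} (hη : 0 < η)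
    (hθ : 0 ≤ θ) {A : ℝ → E →L[ℝ] E} {d : ℝ → E}
    (hd : ∀ t, 0 ≤ t → HasDerivAt d (A t (d t)) t)
    (hA : ∀ t, 0 ≤ t → ∀ v, η * ‖v‖ ^ 2 + 2 * θ * Q v v ≤ Q (A t v) v + Q v (A t v))
    {R : ℝ} (hR : ∀ t, 0 ≤ t → ‖d t‖ ≤ R) (h0 : 0 ≤ Q (d 0) (d 0)) : d 0 = 0 := by
  set q : ℝ → ℝ := fun s => Q (d s) (d s) with hq
  have hqderiv : ∀ t, 0 ≤ t → HasDerivAt q (Q (A t (d t)) (d t) + Q (d t) (A t (d t))) t :=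
    fun t ht => hasDerivAt_bilin_self Q (hd t ht)
  -- Step 1: `e^{-2θ t} q t` is non-decreasing, hence `q ≥ 0` on `[0, ∞)`.
  have hmonoψ : MonotoneOn (fun s => Real.exp (-(2 * θ) * s) * q s) (Ici 0) := by
    have hderiv : ∀ t ∈ Ici (0:ℝ), HasDerivAt (fun s => Real.exp (-(2 * θ) * s) * q s)
        (Real.exp (-(2 * θ) * t) * (-(2 * θ) * q t +
          (Q (A t (d t)) (d t) + Q (d t) (A t (d t))))) t :=
      fun t ht => hasDerivAt_exp_mul_bilin_self Q (hd t ht) _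
    refine monotoneOn_of_hasDerivWithinAt_nonneg (convex_Ici 0)
      (fun t ht => (hderiv t ht).continuousAt.continuousWithinAt)
      (fun t ht => ((hderiv t (interior_subset ht)).hasDerivWithinAt)) ?_
    intro t ht
    have ht' : (0:ℝ) ≤ t := le_of_lt (by simpa using ht)
    have h := hA t ht' (d t)
    refine mul_nonneg (Real.exp_pos _).le ?_
    have : 0 ≤ η * ‖d t‖ ^ 2 := by positivity
    simp only [hq]
    linarith
  have hq_nonneg : ∀ t, 0 ≤ t → 0 ≤ q t := by
    intro t ht
    have h := hmonoψ (self_mem_Ici) (mem_Ici.2 ht) ht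
    simp only [mul_zero, Real.exp_zero, one_mul] at h
    have hpos : 0 < Real.exp (-(2 * θ) * t) := Real.exp_pos _
    by_contra hneg
    push Not at hneg
    have : Real.exp (-(2 * θ) * t) * q t < 0 := mul_neg_of_pos_of_neg hpos hneg
    have h0' : 0 ≤ q 0 := h0
    linarith
  -- Step 2: `q' ≥ η ‖d‖²` on `[0, ∞)`, so `q` is non-decreasing.
  have hq'_ge : ∀ t, 0 ≤ t → η * ‖d t‖ ^ 2 ≤ Q (A t (d t)) (d t) + Q (d t) (A t (d t)) := by
    intro t ht
    have h := hA t ht (d t)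
    have : 0 ≤ 2 * θ * q t := by
      have := hq_nonneg t ht; simp only [hq] at this ⊢; positivity
    simp only [hq] at this
    linarith
  have hmono_q : MonotoneOn q (Ici 0) := by
    refine monotoneOn_of_hasDerivWithinAt_nonneg (convex_Ici 0)
      (fun t ht => (hqderiv t ht).continuousAt.continuousWithinAt)
      (fun t ht => ((hqderiv t (le_of_lt (by simpa using ht))).hasDerivWithinAt)) ?_
    intro t ht
    have ht' : (0:ℝ) ≤ t := le_of_lt (by simpa using ht)
    exact le_trans (by positivity) (hq'_ge t ht')
  -- a priori bound `q t ≤ (‖Q‖ + 1) R²`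
  set K : ℝ := ‖Q‖ + 1 with hK
  have hKpos : 0 < K := by positivity
  have hq_le_K : ∀ t, q t ≤ K * ‖d t‖ ^ 2 := fun t =>
    (bilin_self_le_opNorm_mul Q (d t)).trans (by nlinarith [norm_nonneg (d t)])
  have hR0 : 0 ≤ R := (norm_nonneg _).trans (hR 0 le_rfl)
  have hq_bdd : ∀ t, 0 ≤ t → q t ≤ K * R ^ 2 := fun t ht =>
    (hq_le_K t).trans (mul_le_mul_of_nonneg_left
      (pow_le_pow_left₀ (norm_nonneg _) (hR t ht) 2) hKpos.le)
  -- Step 3: case analysis on whether `q` is ever positive.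
  by_cases hpos : ∃ t₁, 0 ≤ t₁ ∧ 0 < q t₁
  · obtain ⟨t₁, ht₁, hqt₁⟩ := hpos
    -- on `[t₁, ∞)`: `q ≥ q t₁ > 0`, hence `q' ≥ η q t₁ / K =: m > 0`, hence linear growth
    set m : ℝ := η * q t₁ / K with hm
    have hmpos : 0 < m := by positivity
    have hlin : MonotoneOn (fun s => q s - m * s) (Ici t₁) := by
      have hderiv : ∀ t ∈ Ici t₁, HasDerivAt (fun s => q s - m * s)
          (Q (A t (d t)) (d t) + Q (d t) (A t (d t)) - m) t := by
        intro t ht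
        have ht0 : 0 ≤ t := ht₁.trans ht
        have h1 : HasDerivAt (fun s : ℝ => m * s) m t := by
          simpa using (hasDerivAt_id t).const_mul m
        exact (hqderiv t ht0).sub h1
      refine monotoneOn_of_hasDerivWithinAt_nonneg (convex_Ici t₁)
        (fun t ht => (hderiv t ht).continuousAt.continuousWithinAt)
        (fun t ht => ((hderiv t (interior_subset ht)).hasDerivWithinAt)) ?_
      intro t ht
      have ht' : t₁ ≤ t := le_of_lt (by simpa using ht)
      have ht0 : 0 ≤ t := ht₁.trans ht'
      -- `q t ≥ q t₁`, `‖d t‖² ≥ q t / K ≥ q t₁ / K`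
      have hqt : q t₁ ≤ q t := hmono_q (mem_Ici.2 ht₁) (mem_Ici.2 ht0) ht'
      have hd2 : q t₁ / K ≤ ‖d t‖ ^ 2 := by
        rw [div_le_iff₀ hKpos]
        calc q t₁ ≤ q t := hqt
          _ ≤ K * ‖d t‖ ^ 2 := hq_le_K t
          _ = ‖d t‖ ^ 2 * K := by ring
      have h1 := hq'_ge t ht0
      have : m ≤ η * ‖d t‖ ^ 2 := by
        calc m = η * (q t₁ / K) := by simp only [hm]; ring
          _ ≤ η * ‖d t‖ ^ 2 := mul_le_mul_of_nonneg_left hd2 hη.le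
      linarith
    -- choose `t` large: `q t ≥ q t₁ + m (t - t₁) > K R²`
    set t : ℝ := t₁ + (K * R ^ 2 + 1) / m with ht
    have htt₁ : t₁ ≤ t := by
      have : 0 ≤ (K * R ^ 2 + 1) / m := by positivity
      linarith
    have ht0 : 0 ≤ t := ht₁.trans htt₁
    have hgrow := hlin (self_mem_Ici) (mem_Ici.2 htt₁) htt₁
    simp only at hgrow
    have hmt : m * (t - t₁) = K * R ^ 2 + 1 := by
      simp only [ht]; field_simp; ring
    have : K * R ^ 2 + 1 ≤ q t := by nlinarith
    linarith [hq_bdd t ht0]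
  · -- `q ≡ 0` on `[0, ∞)`: then for `t > 0`, `q' t = 0 ≥ η ‖d t‖²`, so `d t = 0`; continuity at `0`.
    push Not at hpos
    have hq0 : ∀ t, 0 ≤ t → q t = 0 := fun t ht => le_antisymm (hpos t ht) (hq_nonneg t ht)
    have hdt : ∀ t, 0 < t → d t = 0 := by
      intro t ht
      -- `q` agrees with `0` near `t`, so its derivative there is `0`
      have hEq : (fun s => q s) =ᶠ[𝓝 t] fun _ => (0:ℝ) := by
        filter_upwards [Ioi_mem_nhds ht] with s hs using hq0 s (le_of_lt hs)
      have hD0 : HasDerivAt q 0 t := (hasDerivAt_const t (0:ℝ)).congr_of_eventuallyEq hEq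
      have huniq := (hqderiv t ht.le).unique hD0
      have h := hq'_ge t ht.le
      rw [huniq] at h
      have hsq : ‖d t‖ ^ 2 ≤ 0 := by
        by_contra hne; push Not at hne
        have := mul_pos hη hne
        linarith
      have : ‖d t‖ = 0 := by nlinarith [norm_nonneg (d t)]
      exact norm_eq_zero.1 this
    -- `d` is continuous at `0` and vanishes on `(0, ∞)`
    have hcont : ContinuousAt d 0 := (hd 0 le_rfl).continuousAt
    have hlim : Tendsto d (𝓝[>] (0:ℝ)) (𝓝 (d 0)) := hcont.continuousWithinAt.tendsto
    have hlim0 : Tendsto d (𝓝[>] (0:ℝ)) (𝓝 0) := by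
      refine tendsto_const_nhds.congr' ?_
      filter_upwards [self_mem_nhdsWithin] with s hs using (hdt s hs).symm
    exact tendsto_nhds_unique hlim hlim0

/-- **Contrapositive packaging (the cone lemma).** Under the cone certificate of
`eq_zero_of_bounded_of_cone_certificate`, a solution of `d' = A(t) d` bounded on `[0, ∞)` with
`d(0) ≠ 0` starts strictly outside the closed cone: `Q(d(0), d(0)) < 0`.
[cite: KatokHasselblatt1995, §6.2 (cone criterion)] -/
theorem cone_certificate_neg_of_bounded (Q : E →L[ℝ] E →L[ℝ] ℝ) {η θ : ℝ} (hη : 0 < η)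
    (hθ : 0 ≤ θ) {A : ℝ → E →L[ℝ] E} {d : ℝ → E}
    (hd : ∀ t, 0 ≤ t → HasDerivAt d (A t (d t)) t)
    (hA : ∀ t, 0 ≤ t → ∀ v, η * ‖v‖ ^ 2 + 2 * θ * Q v v ≤ Q (A t v) v + Q v (A t v))
    {R : ℝ} (hR : ∀ t, 0 ≤ t → ‖d t‖ ≤ R) (h0 : d 0 ≠ 0) : Q (d 0) (d 0) < 0 := by
  by_contra h
  push Not at h
  exact h0 (eq_zero_of_bounded_of_cone_certificate Q hη hθ hd hA hR h)

/-! ### Nonlinear packaging: the certificate along the actual derivative -/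

/-- The weighted quantity `e^{a t} Q(d,d)` along a curve with derivative `e(t)` has derivative
`e^{a t}(a Q(d,d) + Q(e, d) + Q(d, e))`. [folklore] -/
private theorem hasDerivAt_exp_mul_bilin_self' (Q : E →L[ℝ] E →L[ℝ] ℝ) {d e : ℝ → E}
    {t : ℝ} (hd : HasDerivAt d (e t) t) (a : ℝ) :
    HasDerivAt (fun s => Real.exp (a * s) * Q (d s) (d s))
      (Real.exp (a * t) * (a * Q (d t) (d t) + (Q (e t) (d t) + Q (d t) (e t)))) t := by
  have h1 : HasDerivAt (fun s : ℝ => Real.exp (a * s)) (Real.exp (a * t) * (a * 1)) t :=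
    ((hasDerivAt_id t).const_mul a).exp
  have h2 := hasDerivAt_bilin_self Q hd
  refine (h1.mul h2).congr_deriv ?_
  ring

/-- **The cone lemma along a nonlinear equation.** Same as `eq_zero_of_bounded_of_cone_certificate`,
but the S-procedure inequality is only assumed ALONG THE CURVE, for its actual derivative `e(t)`:
if `d' = e` on `[0, ∞)` with `Q(e(t), d(t)) + Q(d(t), e(t)) ≥ η‖d(t)‖² + 2θ Q(d(t), d(t))` (`η > 0`,
`θ ≥ 0`), `d` is bounded on `[0, ∞)` and `Q(d(0), d(0)) ≥ 0`, then `d(0) = 0`.  (This is the form used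
for the DIFFERENCE of two trajectories of a `C¹` vector field near a point whose linearisation has a
strict cone certificate: the mean value inequality puts the nonlinear remainder into `η`.)
[cite: KatokHasselblatt1995, §6.2 (cone criterion)] [cite: Hartman2002, Ch. IX] -/
theorem eq_zero_of_bounded_of_cone_certificate_deriv (Q : E →L[ℝ] E →L[ℝ] ℝ) {η θ : ℝ} (hη : 0 < η)
    (hθ : 0 ≤ θ) {d e : ℝ → E}
    (hd : ∀ t, 0 ≤ t → HasDerivAt d (e t) t)
    (hA : ∀ t, 0 ≤ t → η * ‖d t‖ ^ 2 + 2 * θ * Q (d t) (d t) ≤ Q (e t) (d t) + Q (d t) (e t))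
    {R : ℝ} (hR : ∀ t, 0 ≤ t → ‖d t‖ ≤ R) (h0 : 0 ≤ Q (d 0) (d 0)) : d 0 = 0 := by
  set q : ℝ → ℝ := fun s => Q (d s) (d s) with hq
  have hqderiv : ∀ t, 0 ≤ t → HasDerivAt q (Q (e t) (d t) + Q (d t) (e t)) t :=
    fun t ht => hasDerivAt_bilin_self Q (hd t ht)
  -- Step 1: `e^{-2θ t} q t` is non-decreasing, hence `q ≥ 0` on `[0, ∞)`.
  have hmonoψ : MonotoneOn (fun s => Real.exp (-(2 * θ) * s) * q s) (Ici 0) := by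
    have hderiv : ∀ t ∈ Ici (0:ℝ), HasDerivAt (fun s => Real.exp (-(2 * θ) * s) * q s)
        (Real.exp (-(2 * θ) * t) * (-(2 * θ) * q t + (Q (e t) (d t) + Q (d t) (e t)))) t :=
      fun t ht => hasDerivAt_exp_mul_bilin_self' Q (hd t ht) _
    refine monotoneOn_of_hasDerivWithinAt_nonneg (convex_Ici 0)
      (fun t ht => (hderiv t ht).continuousAt.continuousWithinAt)
      (fun t ht => ((hderiv t (interior_subset ht)).hasDerivWithinAt)) ?_
    intro t ht
    have ht' : (0:ℝ) ≤ t := le_of_lt (by simpa using ht)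
    have h := hA t ht'
    refine mul_nonneg (Real.exp_pos _).le ?_
    have : 0 ≤ η * ‖d t‖ ^ 2 := by positivity
    simp only [hq]
    linarith
  have hq_nonneg : ∀ t, 0 ≤ t → 0 ≤ q t := by
    intro t ht
    have h := hmonoψ (self_mem_Ici) (mem_Ici.2 ht) ht
    simp only [mul_zero, Real.exp_zero, one_mul] at h
    have hpos : 0 < Real.exp (-(2 * θ) * t) := Real.exp_pos _
    by_contra hneg
    push Not at hneg
    have : Real.exp (-(2 * θ) * t) * q t < 0 := mul_neg_of_pos_of_neg hpos hneg
    have h0' : 0 ≤ q 0 := h0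
    linarith
  -- Step 2: `q' ≥ η ‖d‖²` on `[0, ∞)`, so `q` is non-decreasing.
  have hq'_ge : ∀ t, 0 ≤ t → η * ‖d t‖ ^ 2 ≤ Q (e t) (d t) + Q (d t) (e t) := by
    intro t ht
    have h := hA t ht
    have : 0 ≤ 2 * θ * q t := by
      have := hq_nonneg t ht; simp only [hq] at this ⊢; positivity
    simp only [hq] at this
    linarith
  have hmono_q : MonotoneOn q (Ici 0) := by
    refine monotoneOn_of_hasDerivWithinAt_nonneg (convex_Ici 0)
      (fun t ht => (hqderiv t ht).continuousAt.continuousWithinAt)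
      (fun t ht => ((hqderiv t (le_of_lt (by simpa using ht))).hasDerivWithinAt)) ?_
    intro t ht
    have ht' : (0:ℝ) ≤ t := le_of_lt (by simpa using ht)
    exact le_trans (by positivity) (hq'_ge t ht')
  -- a priori bound `q t ≤ (‖Q‖ + 1) R²`
  set K : ℝ := ‖Q‖ + 1 with hK
  have hKpos : 0 < K := by positivity
  have hq_le_K : ∀ t, q t ≤ K * ‖d t‖ ^ 2 := fun t =>
    (bilin_self_le_opNorm_mul Q (d t)).trans (by nlinarith [norm_nonneg (d t)])
  have hR0 : 0 ≤ R := (norm_nonneg _).trans (hR 0 le_rfl)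
  have hq_bdd : ∀ t, 0 ≤ t → q t ≤ K * R ^ 2 := fun t ht =>
    (hq_le_K t).trans (mul_le_mul_of_nonneg_left
      (pow_le_pow_left₀ (norm_nonneg _) (hR t ht) 2) hKpos.le)
  -- Step 3: case analysis on whether `q` is ever positive.
  by_cases hpos : ∃ t₁, 0 ≤ t₁ ∧ 0 < q t₁
  · obtain ⟨t₁, ht₁, hqt₁⟩ := hpos
    set m : ℝ := η * q t₁ / K with hm
    have hmpos : 0 < m := by positivity
    have hlin : MonotoneOn (fun s => q s - m * s) (Ici t₁) := by
      have hderiv : ∀ t ∈ Ici t₁, HasDerivAt (fun s => q s - m * s)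
          (Q (e t) (d t) + Q (d t) (e t) - m) t := by
        intro t ht
        have ht0 : 0 ≤ t := ht₁.trans ht
        have h1 : HasDerivAt (fun s : ℝ => m * s) m t := by
          simpa using (hasDerivAt_id t).const_mul m
        exact (hqderiv t ht0).sub h1
      refine monotoneOn_of_hasDerivWithinAt_nonneg (convex_Ici t₁)
        (fun t ht => (hderiv t ht).continuousAt.continuousWithinAt)
        (fun t ht => ((hderiv t (interior_subset ht)).hasDerivWithinAt)) ?_
      intro t ht
      have ht' : t₁ ≤ t := le_of_lt (by simpa using ht)
      have ht0 : 0 ≤ t := ht₁.trans ht'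
      have hqt : q t₁ ≤ q t := hmono_q (mem_Ici.2 ht₁) (mem_Ici.2 ht0) ht'
      have hd2 : q t₁ / K ≤ ‖d t‖ ^ 2 := by
        rw [div_le_iff₀ hKpos]
        calc q t₁ ≤ q t := hqt
          _ ≤ K * ‖d t‖ ^ 2 := hq_le_K t
          _ = ‖d t‖ ^ 2 * K := by ring
      have h1 := hq'_ge t ht0
      have : m ≤ η * ‖d t‖ ^ 2 := by
        calc m = η * (q t₁ / K) := by simp only [hm]; ring
          _ ≤ η * ‖d t‖ ^ 2 := mul_le_mul_of_nonneg_left hd2 hη.le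
      linarith
    set t : ℝ := t₁ + (K * R ^ 2 + 1) / m with ht
    have htt₁ : t₁ ≤ t := by
      have : 0 ≤ (K * R ^ 2 + 1) / m := by positivity
      linarith
    have ht0 : 0 ≤ t := ht₁.trans htt₁
    have hgrow := hlin (self_mem_Ici) (mem_Ici.2 htt₁) htt₁
    simp only at hgrow
    have hmt : m * (t - t₁) = K * R ^ 2 + 1 := by
      simp only [ht]; field_simp; ring
    have : K * R ^ 2 + 1 ≤ q t := by nlinarith
    linarith [hq_bdd t ht0]
  · push Not at hpos
    have hq0 : ∀ t, 0 ≤ t → q t = 0 := fun t ht => le_antisymm (hpos t ht) (hq_nonneg t ht)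
    have hdt : ∀ t, 0 < t → d t = 0 := by
      intro t ht
      have hEq : (fun s => q s) =ᶠ[𝓝 t] fun _ => (0:ℝ) := by
        filter_upwards [Ioi_mem_nhds ht] with s hs using hq0 s (le_of_lt hs)
      have hD0 : HasDerivAt q 0 t := (hasDerivAt_const t (0:ℝ)).congr_of_eventuallyEq hEq
      have huniq := (hqderiv t ht.le).unique hD0
      have h := hq'_ge t ht.le
      rw [huniq] at h
      have hsq : ‖d t‖ ^ 2 ≤ 0 := by
        by_contra hne; push Not at hne
        have := mul_pos hη hne
        linarith
      have : ‖d t‖ = 0 := by nlinarith [norm_nonneg (d t)]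
      exact norm_eq_zero.1 this
    have hcont : ContinuousAt d 0 := (hd 0 le_rfl).continuousAt
    have hlim : Tendsto d (𝓝[>] (0:ℝ)) (𝓝 (d 0)) := hcont.continuousWithinAt.tendsto
    have hlim0 : Tendsto d (𝓝[>] (0:ℝ)) (𝓝 0) := by
      refine tendsto_const_nhds.congr' ?_
      filter_upwards [self_mem_nhdsWithin] with s hs using (hdt s hs).symm
    exact tendsto_nhds_unique hlim hlim0

/-- **Contrapositive packaging along a nonlinear equation**: under the hypotheses of
`eq_zero_of_bounded_of_cone_certificate_deriv` except `Q(d(0), d(0)) ≥ 0`, a bounded curve with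
`d(0) ≠ 0` has `Q(d(0), d(0)) < 0`. [cite: KatokHasselblatt1995, §6.2 (cone criterion)] -/
theorem cone_certificate_neg_of_bounded_deriv (Q : E →L[ℝ] E →L[ℝ] ℝ) {η θ : ℝ} (hη : 0 < η)
    (hθ : 0 ≤ θ) {d e : ℝ → E}
    (hd : ∀ t, 0 ≤ t → HasDerivAt d (e t) t)
    (hA : ∀ t, 0 ≤ t → η * ‖d t‖ ^ 2 + 2 * θ * Q (d t) (d t) ≤ Q (e t) (d t) + Q (d t) (e t))
    {R : ℝ} (hR : ∀ t, 0 ≤ t → ‖d t‖ ≤ R) (h0 : d 0 ≠ 0) : Q (d 0) (d 0) < 0 := by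
  by_contra h
  push Not at h
  exact h0 (eq_zero_of_bounded_of_cone_certificate_deriv Q hη hθ hd hA hR h)

end Literature.Analysis.ODE
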